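import Summits.NavierStokesRegularity.NavierStokesRegularity.Theorems.ExtremiserTransienceNearExtremalTransienceExtremiserLiouvilleConstantSpeedSlideEnstrophyPlanar
import Literature.Analysis.FluidPDE.WholeSpaceIBPIntegrable
import Literature.Analysis.FluidPDE.TaoEnstrophyLocalisationProofs
import HarnessLib

/-!
# Crux `ExtremiserTransience.NearExtremalTransience` (stmt-NavierStokesRegularity-21883), line `extremiser_liouville`,
# stub K1b — IDENTITY (P) `∫γ|Dω|²_F = ∫γ|D²V|²_F − ∫γ″|∇V₂|²` FOR DIVERGENCE-FREE `V` BY A DIVERGENCE CERTIFICATE (record §16, R6a-int)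

`--supports stmt-NavierStokesRegularity-21883` (helper).  Author: prover seat `ns-el-k1b` (g9).

The weighted palinstrophy `∫γ(x₂)|Dω|²_F` (`ω = curl V`) is the leading `Z′`-density of `Ĉ₁` in the layer inequality (INEQ)₃
(`…ConstantSpeedSlideInequalityLayer`, `−½∫g′|Dω|²_F`).  For the absorption ledger (record §15, R6b) it must be converted into
the coercive `D²V`-quadratic form.  This file proves, for a divergence-free `V ∈ C^∞` with `DV, D²V ∈ L²` and a `C²` axial weight
`γ` with `γ, γ′, γ″` bounded,
```
  (P)   ∫γ(x₂)|Dω|²_F = Σₖ∫γ(x₂)|D∂ₖV|²_F − ∫γ″(x₂)|∇V₂|²        (|D²V|²_F = Σₖ|D∂ₖV|²_F, |∇V₂|² = Σₖ(∂ₖV₂)²),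
```
by the method of record §16 (addendum): (P) is `∫div X = 0` for the explicit `C¹` flux
`X = Σₖ[γ(x₂)·(∂ₖV·∇)∂ₖV − γ′(x₂)(∂ₖV₂)·∂ₖV]` (a sum of weight·`DV`·`D²V` and weight·`DV`·`DV` products, so `X, div X ∈ L¹`),
whose divergence is, pointwise, `γ Σₖ tr(D∂ₖV∘D∂ₖV) − γ″|∇V₂|²` (the `D³V` terms cancel by the symmetry of `D²(∂ₖV)`,
`Literature…divergence_smul_convect_sub`; `div ∂ₖV = 0`), and `tr(Du∘Du) = |Du|²_F − |curl u|²`, `curl ∂ₖV = ∂ₖω`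
(`Literature…frobeniusNormSq_fderiv_eq_sq_norm_curl_add_trace`, `curl_fderiv_apply`).
* `divergence_fun_sum_eq` : divergence of a finite sum (the `smul`/`sub` steps are inlined via `traceCLM`);
* `divergence_palinstrophyFlux` : the pointwise certificate for one direction `e`;
* `integral_axialWeight_frobeniusNormSq_fderiv_curl_eq` : **(P)**.

WHAT THIS IS NOT: K1b is NOT proved; nothing here proves NS regularity. [folklore]
-/

noncomputable section

open Set Filter Topology MeasureTheory Metric Function InnerProductSpace
open scoped ENNReal NNReal Topology InnerProductSpace RealInnerProductSpace ContDiff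
open Literature.Analysis.FluidPDE Literature.Analysis

namespace Summit.NavierStokesRegularity.NavierStokesRegularity.Theorems

-- the problem directory repeats the summit name (`NavierStokesRegularity/NavierStokesRegularity`)
set_option linter.dupNamespace false

namespace ExtremiserLiouville

open DepletionLadder.KStar

variable {V : EuclideanSpace ℝ (Fin 3) → EuclideanSpace ℝ (Fin 3)} {γ : ℝ → ℝ}

/-! ## 1. Divergence algebra -/

/-- `div(Σᵢ vᵢ) = Σᵢ div vᵢ`. [folklore] -/
theorem divergence_fun_sum_eq {ι : Type*} (s : Finset ι) {v : ι → EuclideanSpace ℝ (Fin 3) → EuclideanSpace ℝ (Fin 3)} {x : EuclideanSpace ℝ (Fin 3)}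
    (hv : ∀ i ∈ s, DifferentiableAt ℝ (v i) x) :
    VectorCalculus.divergence (fun y => ∑ i ∈ s, v i y) x = ∑ i ∈ s, VectorCalculus.divergence (v i) x := by
  rw [divergence_eq_traceCLM, fderiv_fun_sum hv, map_sum]
  rfl

/-! ## 2. The pointwise certificate -/

/-- **The pointwise certificate, one direction.**  For a divergence-free `V ∈ C^∞`, `γ ∈ C²` and a vector `e`, with `u = ∂ₑV`
(`= DV(·)e`, again divergence free):
`div( γ(x₂)·Du(u) − γ′(x₂)u₂·u ) = γ(x₂)·tr(Du∘Du) − γ″(x₂)u₂²`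
(the terms `γ′(x₂)(Du u)₂` cancel; the `D²u = D³V` terms cancel inside `divergence_smul_convect_sub`). [folklore] -/
theorem divergence_palinstrophyFlux (hV : ContDiff ℝ ∞ V) (hdiv : VectorCalculus.IsDivFree V) (hγ : ContDiff ℝ 2 γ)
    (e x : EuclideanSpace ℝ (Fin 3)) :
    VectorCalculus.divergence (fun y => γ (y 2) • fderiv ℝ (fun z => fderiv ℝ V z e) y (fderiv ℝ V y e) -
        (deriv γ (y 2) * fderiv ℝ V y e 2) • fderiv ℝ V y e) x =
      γ (x 2) * traceCLM ((fderiv ℝ (fun z => fderiv ℝ V z e) x).comp (fderiv ℝ (fun z => fderiv ℝ V z e) x)) -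
        deriv (deriv γ) (x 2) * (fderiv ℝ V x e 2) ^ 2 := by
  have lt2 : (2 : WithTop ℕ∞) ≤ ((⊤ : ℕ∞) : WithTop ℕ∞) := WithTop.coe_le_coe.mpr le_top
  have hV2 : ContDiff ℝ 2 V := hV.of_le lt2
  have hu : ContDiff ℝ ∞ fun z => fderiv ℝ V z e := (hV.fderiv_right (m := ∞) (by exact_mod_cast le_rfl)).clm_apply contDiff_const
  have hu2 : ContDiff ℝ 2 fun z => fderiv ℝ V z e := hu.of_le lt2
  have hud : Differentiable ℝ fun z => fderiv ℝ V z e := hu.differentiable (by simp)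
  have hDud : Differentiable ℝ fun y => fderiv ℝ (fun z => fderiv ℝ V z e) y :=
    (hu.fderiv_right (m := ∞) (by exact_mod_cast le_rfl)).differentiable (by simp)
  have hdu0 : ∀ y, VectorCalculus.divergence (fun z => fderiv ℝ V z e) y = 0 := hdiv.fderiv_apply hV2 e
  have hγd : Differentiable ℝ γ := hγ.differentiable (by norm_num)
  have hγ'c : ContDiff ℝ 1 (deriv γ) := by
    have h2 : ContDiff ℝ (1 + 1) γ := by rw [show ((1 : WithTop ℕ∞) + 1) = 2 by norm_num]; exact hγ
    exact h2.deriv'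
  have hγ'd : Differentiable ℝ (deriv γ) := hγ'c.differentiable one_ne_zero
  have cγ : ContDiff ℝ 1 fun y : EuclideanSpace ℝ (Fin 3) => γ (y 2) :=
    (hγ.of_le (by norm_num)).comp (EuclideanSpace.proj (2 : Fin 3) : EuclideanSpace ℝ (Fin 3) →L[ℝ] ℝ).contDiff
  have cγd : DifferentiableAt ℝ (fun y : EuclideanSpace ℝ (Fin 3) => γ (y 2)) x := (cγ.differentiable one_ne_zero) x
  have cγ'd : DifferentiableAt ℝ (fun y : EuclideanSpace ℝ (Fin 3) => deriv γ (y 2)) x := (hasFDerivAt_comp_coord_two hγ'd x).differentiableAt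
  have hc2 : DifferentiableAt ℝ (fun y : EuclideanSpace ℝ (Fin 3) => fderiv ℝ V y e 2) x :=
    ((EuclideanSpace.proj (2 : Fin 3) : EuclideanSpace ℝ (Fin 3) →L[ℝ] ℝ).differentiableAt).comp x (hud x)
  -- the convective part
  have h1 := divergence_smul_convect_sub (fun z => fderiv ℝ V z e) hu2 cγ x
  have hfun : (fun y : EuclideanSpace ℝ (Fin 3) => γ (y 2) • (fderiv ℝ (fun z => fderiv ℝ V z e) y (fderiv ℝ V y e) -
      VectorCalculus.divergence (fun z => fderiv ℝ V z e) y • fderiv ℝ V y e)) =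
      fun y => γ (y 2) • fderiv ℝ (fun z => fderiv ℝ V z e) y (fderiv ℝ V y e) := by
    funext y; rw [hdu0, zero_smul, sub_zero]
  rw [hfun, hdu0, zero_smul, sub_zero, (hasFDerivAt_comp_coord_two hγd x).fderiv] at h1
  -- the correction part
  have h2 : VectorCalculus.divergence (fun y : EuclideanSpace ℝ (Fin 3) => (deriv γ (y 2) * fderiv ℝ V y e 2) • fderiv ℝ V y e) x =
      (deriv γ (x 2) * fderiv ℝ V x e 2) * 0 + (deriv γ (x 2) * fderiv ℝ (fun z => fderiv ℝ V z e) x (fderiv ℝ V x e) 2 +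
        fderiv ℝ V x e 2 * (deriv (deriv γ) (x 2) * fderiv ℝ V x e 2)) := by
    have hcd : DifferentiableAt ℝ (fun y : EuclideanSpace ℝ (Fin 3) => deriv γ (y 2) * fderiv ℝ V y e 2) x := cγ'd.mul hc2
    rw [divergence_eq_traceCLM, fderiv_fun_smul hcd (hud x), map_add, traceCLM_smulRight, map_smul, ← divergence_eq_traceCLM,
      smul_eq_mul, hdu0, fderiv_fun_mul cγ'd hc2]
    simp only [add_apply, smul_apply, smul_eq_mul]
    rw [fderiv_coord_apply (hud x) 2, (hasFDerivAt_comp_coord_two hγ'd x).fderiv]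
    simp only [smul_apply, proj_two_apply, smul_eq_mul]
  have hA : DifferentiableAt ℝ (fun y : EuclideanSpace ℝ (Fin 3) => γ (y 2) • fderiv ℝ (fun z => fderiv ℝ V z e) y (fderiv ℝ V y e)) x :=
    cγd.smul ((hDud x).clm_apply (hud x))
  have hcd : DifferentiableAt ℝ (fun y : EuclideanSpace ℝ (Fin 3) => deriv γ (y 2) * fderiv ℝ V y e 2) x := cγ'd.mul hc2
  have hB : DifferentiableAt ℝ (fun y : EuclideanSpace ℝ (Fin 3) => (deriv γ (y 2) * fderiv ℝ V y e 2) • fderiv ℝ V y e) x :=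
    hcd.smul (hud x)
  rw [divergence_eq_traceCLM, fderiv_fun_sub hA hB, map_sub, ← divergence_eq_traceCLM, ← divergence_eq_traceCLM, h1, h2]
  simp only [smul_apply, proj_two_apply, smul_eq_mul]
  ring

/-- `tr(Du∘Du) = |Du|²_F − |∂ₑω|²` for `u = ∂ₑV`, `ω = curl V` (`V ∈ C²`). [folklore] -/
theorem traceCLM_comp_fderiv_fderiv_eq (hV : ContDiff ℝ 2 V) (e x : EuclideanSpace ℝ (Fin 3)) :
    traceCLM ((fderiv ℝ (fun z => fderiv ℝ V z e) x).comp (fderiv ℝ (fun z => fderiv ℝ V z e) x)) =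
      frobeniusNormSq (fderiv ℝ (fun z => fderiv ℝ V z e) x) - ‖fderiv ℝ (curl V) x e‖ ^ 2 := by
  rw [frobeniusNormSq_fderiv_eq_sq_norm_curl_add_trace, curl_fderiv_apply hV]
  ring

/-! ## 3. Identity (P) -/

/-- **(P) `∫γ(x₂)|Dω|²_F = Σₖ∫γ(x₂)|D∂ₖV|²_F − ∫γ″(x₂)Σₖ(∂ₖV₂)²`** for a divergence-free `V ∈ C^∞(ℝ³)` with `DV, D²V ∈ L²`
and an axial weight `γ ∈ C²` with `γ, γ′, γ″` bounded (`ω = curl V`; `Σₖ|D∂ₖV|²_F = |D²V|²_F`, `Σₖ(∂ₖV₂)² = |∇V₂|²`).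
Divergence certificate `divergence_palinstrophyFlux`; no slab hypothesis, no `D³V` integrability. [folklore] -/
theorem integral_axialWeight_frobeniusNormSq_fderiv_curl_eq (hV : ContDiff ℝ ∞ V) (hdiv : VectorCalculus.IsDivFree V)
    (hγ : ContDiff ℝ 2 γ) {K : ℝ} (hK0 : ∀ s, |γ s| ≤ K) (hK1 : ∀ s, |deriv γ s| ≤ K) (hK2 : ∀ s, |deriv (deriv γ) s| ≤ K)
    (i1 : Integrable (fun y => ‖fderiv ℝ V y‖ ^ 2) (volume : Measure (EuclideanSpace ℝ (Fin 3))))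
    (i2 : Integrable (fun y => ‖iteratedFDeriv ℝ 2 V y‖ ^ 2) (volume : Measure (EuclideanSpace ℝ (Fin 3)))) :
    (∫ x, γ (x 2) * frobeniusNormSq (fderiv ℝ (curl V) x)) =
      (∫ x, γ (x 2) * ∑ k : Fin 3, frobeniusNormSq (fderiv ℝ (fun z => fderiv ℝ V z (EuclideanSpace.basisFun (Fin 3) ℝ k)) x)) -
        ∫ x, deriv (deriv γ) (x 2) * ∑ k : Fin 3, (fderiv ℝ V x (EuclideanSpace.basisFun (Fin 3) ℝ k) 2) ^ 2 := by
  have hKnn : 0 ≤ K := (abs_nonneg _).trans (hK0 0)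
  have nb : ∀ k : Fin 3, ‖EuclideanSpace.basisFun (Fin 3) ℝ k‖ = 1 := fun k => (EuclideanSpace.basisFun (Fin 3) ℝ).orthonormal.norm_eq_one k
  have lt2 : (2 : WithTop ℕ∞) ≤ ((⊤ : ℕ∞) : WithTop ℕ∞) := WithTop.coe_le_coe.mpr le_top
  have hV2 : ContDiff ℝ 2 V := hV.of_le lt2
  have lt1 : ((1 : ℕ) : WithTop ℕ∞) ≤ ((⊤ : ℕ∞) : WithTop ℕ∞) := WithTop.coe_le_coe.mpr le_top
  have hu : ∀ k : Fin 3, ContDiff ℝ ∞ fun z => fderiv ℝ V z (EuclideanSpace.basisFun (Fin 3) ℝ k) := fun k =>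
    (hV.fderiv_right (m := ∞) (by exact_mod_cast le_rfl)).clm_apply contDiff_const
  have hDu : ∀ k : Fin 3, ContDiff ℝ ∞ fun y => fderiv ℝ (fun z => fderiv ℝ V z (EuclideanSpace.basisFun (Fin 3) ℝ k)) y := fun k =>
    (hu k).fderiv_right (m := ∞) (by exact_mod_cast le_rfl)
  have hγd : Differentiable ℝ γ := hγ.differentiable (by norm_num)
  have hγ'c : ContDiff ℝ 1 (deriv γ) := by
    have h2 : ContDiff ℝ (1 + 1) γ := by rw [show ((1 : WithTop ℕ∞) + 1) = 2 by norm_num]; exact hγ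
    exact h2.deriv'
  have hγ'd : Differentiable ℝ (deriv γ) := hγ'c.differentiable one_ne_zero
  have cγ : ContDiff ℝ 1 fun y : EuclideanSpace ℝ (Fin 3) => γ (y 2) :=
    (hγ.of_le (by norm_num)).comp (EuclideanSpace.proj (2 : Fin 3) : EuclideanSpace ℝ (Fin 3) →L[ℝ] ℝ).contDiff
  have cγ' : ContDiff ℝ 1 fun y : EuclideanSpace ℝ (Fin 3) => deriv γ (y 2) := hγ'c.comp (EuclideanSpace.proj (2 : Fin 3) : EuclideanSpace ℝ (Fin 3) →L[ℝ] ℝ).contDiff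
  have cγ'' : Continuous fun y : EuclideanSpace ℝ (Fin 3) => deriv (deriv γ) (y 2) :=
    (hγ'c.continuous_deriv le_rfl).comp (EuclideanSpace.proj (2 : Fin 3) : EuclideanSpace ℝ (Fin 3) →L[ℝ] ℝ).continuous
  have hc2 : ∀ k : Fin 3, ContDiff ℝ ∞ fun y : EuclideanSpace ℝ (Fin 3) => fderiv ℝ V y (EuclideanSpace.basisFun (Fin 3) ℝ k) 2 := fun k =>
    (EuclideanSpace.proj (2 : Fin 3) : EuclideanSpace ℝ (Fin 3) →L[ℝ] ℝ).contDiff.comp (hu k)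
  -- the summands of the flux are `C¹`
  have hXk : ∀ k : Fin 3, ContDiff ℝ 1 fun y : EuclideanSpace ℝ (Fin 3) => (γ (y 2) • fderiv ℝ (fun z => fderiv ℝ V z (EuclideanSpace.basisFun (Fin 3) ℝ k)) y (fderiv ℝ V y (EuclideanSpace.basisFun (Fin 3) ℝ k)) - (deriv γ (y 2) * fderiv ℝ V y (EuclideanSpace.basisFun (Fin 3) ℝ k) 2) • fderiv ℝ V y (EuclideanSpace.basisFun (Fin 3) ℝ k)) := fun k =>
    (cγ.smul (((hDu k).clm_apply (hu k)).of_le lt1)).sub ((cγ'.mul ((hc2 k).of_le lt1)).smul ((hu k).of_le lt1))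
  have hX1 : ContDiff ℝ 1 fun y : EuclideanSpace ℝ (Fin 3) => ∑ k : Fin 3, (γ (y 2) • fderiv ℝ (fun z => fderiv ℝ V z (EuclideanSpace.basisFun (Fin 3) ℝ k)) y (fderiv ℝ V y (EuclideanSpace.basisFun (Fin 3) ℝ k)) - (deriv γ (y 2) * fderiv ℝ V y (EuclideanSpace.basisFun (Fin 3) ℝ k) 2) • fderiv ℝ V y (EuclideanSpace.basisFun (Fin 3) ℝ k)) := ContDiff.sum fun k _ => hXk k
  -- norm bookkeeping
  have nu : ∀ (k : Fin 3) (y : EuclideanSpace ℝ (Fin 3)), ‖fderiv ℝ V y (EuclideanSpace.basisFun (Fin 3) ℝ k)‖ ≤ ‖fderiv ℝ V y‖ := fun k y => by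
    simpa [nb k] using (fderiv ℝ V y).le_opNorm (EuclideanSpace.basisFun (Fin 3) ℝ k)
  have nDu : ∀ (k : Fin 3) (y : EuclideanSpace ℝ (Fin 3)), ‖fderiv ℝ (fun z => fderiv ℝ V z (EuclideanSpace.basisFun (Fin 3) ℝ k)) y‖ ≤ ‖iteratedFDeriv ℝ 2 V y‖ := fun k y => by
    rw [fderiv_fderiv_apply_eq hV2 y]
    have e1 : ‖fderiv ℝ (fderiv ℝ V) y‖ = ‖iteratedFDeriv ℝ 2 V y‖ := by
      rw [← norm_iteratedFDeriv_zero (𝕜 := ℝ) (f := fderiv ℝ (fderiv ℝ V)), norm_iteratedFDeriv_fderiv,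
        norm_iteratedFDeriv_fderiv]
    rw [← e1]
    simpa [nb k] using (fderiv ℝ (fderiv ℝ V) y).le_opNorm (EuclideanSpace.basisFun (Fin 3) ℝ k)
  have n2 : ∀ w : EuclideanSpace ℝ (Fin 3), (w 2) ^ 2 ≤ ‖w‖ ^ 2 := fun w => by
    rw [EuclideanSpace.norm_sq_eq, ← sq_abs (w 2), ← Real.norm_eq_abs]
    exact Finset.single_le_sum (f := fun i => ‖w i‖ ^ 2) (fun _ _ => sq_nonneg _) (Finset.mem_univ 2)
  have frob_le : ∀ L : EuclideanSpace ℝ (Fin 3) →L[ℝ] EuclideanSpace ℝ (Fin 3), frobeniusNormSq L ≤ 3 * ‖L‖ ^ 2 := fun L => by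
    rw [frobeniusNormSq_eq_sum (EuclideanSpace.basisFun (Fin 3) ℝ)]
    have := sum_sq_norm_apply_le_card_mul_sq_opNorm (EuclideanSpace.basisFun (Fin 3) ℝ) L
    rwa [Fintype.card_fin, Nat.cast_ofNat] at this
  have ncurl : ∀ y : EuclideanSpace ℝ (Fin 3), ‖fderiv ℝ (curl V) y‖ ≤ 4 * ‖iteratedFDeriv ℝ 2 V y‖ := fun y => by
    have h := norm_iteratedFDeriv_curl_le_four hV 1 y
    rwa [← norm_iteratedFDeriv_fderiv, norm_iteratedFDeriv_zero] at h
  -- the flux is integrable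
  have cu : ∀ k : Fin 3, Continuous fun y : EuclideanSpace ℝ (Fin 3) => fderiv ℝ V y (EuclideanSpace.basisFun (Fin 3) ℝ k) := fun k => (hu k).continuous
  have cDu : ∀ k : Fin 3, Continuous fun y : EuclideanSpace ℝ (Fin 3) => fderiv ℝ (fun z => fderiv ℝ V z (EuclideanSpace.basisFun (Fin 3) ℝ k)) y := fun k => (hDu k).continuous
  have iXk : ∀ k : Fin 3, Integrable (fun y : EuclideanSpace ℝ (Fin 3) => (γ (y 2) • fderiv ℝ (fun z => fderiv ℝ V z (EuclideanSpace.basisFun (Fin 3) ℝ k)) y (fderiv ℝ V y (EuclideanSpace.basisFun (Fin 3) ℝ k)) - (deriv γ (y 2) * fderiv ℝ V y (EuclideanSpace.basisFun (Fin 3) ℝ k) 2) • fderiv ℝ V y (EuclideanSpace.basisFun (Fin 3) ℝ k))) volume := fun k => by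
    refine ((i2.const_mul K).add (i1.const_mul (2 * K))).mono' (hXk k).continuous.aestronglyMeasurable
      (Eventually.of_forall fun y => ?_)
    simp only [Pi.add_apply]
    have hP := norm_nonneg (fderiv ℝ V y)
    have hQ := norm_nonneg (iteratedFDeriv ℝ 2 V y)
    have a1 := nu k y; have a2 := nDu k y; have g0 := hK0 (y 2); have g1 := hK1 (y 2)
    have b2 : |fderiv ℝ V y (EuclideanSpace.basisFun (Fin 3) ℝ k) 2| ≤ ‖fderiv ℝ V y‖ := (abs_le_of_sq_le_sq' (by nlinarith [n2 (fderiv ℝ V y (EuclideanSpace.basisFun (Fin 3) ℝ k)), a1, norm_nonneg (fderiv ℝ V y (EuclideanSpace.basisFun (Fin 3) ℝ k))]) hP).2 |> fun h => by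
      have := n2 (fderiv ℝ V y (EuclideanSpace.basisFun (Fin 3) ℝ k))
      nlinarith [a1, norm_nonneg (fderiv ℝ V y (EuclideanSpace.basisFun (Fin 3) ℝ k)), abs_nonneg (fderiv ℝ V y (EuclideanSpace.basisFun (Fin 3) ℝ k) 2), sq_abs (fderiv ℝ V y (EuclideanSpace.basisFun (Fin 3) ℝ k) 2)]
    calc ‖(γ (y 2) • fderiv ℝ (fun z => fderiv ℝ V z (EuclideanSpace.basisFun (Fin 3) ℝ k)) y (fderiv ℝ V y (EuclideanSpace.basisFun (Fin 3) ℝ k)) - (deriv γ (y 2) * fderiv ℝ V y (EuclideanSpace.basisFun (Fin 3) ℝ k) 2) • fderiv ℝ V y (EuclideanSpace.basisFun (Fin 3) ℝ k))‖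
        ≤ ‖γ (y 2) • fderiv ℝ (fun z => fderiv ℝ V z (EuclideanSpace.basisFun (Fin 3) ℝ k)) y (fderiv ℝ V y (EuclideanSpace.basisFun (Fin 3) ℝ k))‖ + ‖(deriv γ (y 2) * fderiv ℝ V y (EuclideanSpace.basisFun (Fin 3) ℝ k) 2) • fderiv ℝ V y (EuclideanSpace.basisFun (Fin 3) ℝ k)‖ := norm_sub_le _ _
      _ ≤ K * (‖iteratedFDeriv ℝ 2 V y‖ * ‖fderiv ℝ V y‖) + K * ‖fderiv ℝ V y‖ * ‖fderiv ℝ V y‖ := by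
          refine add_le_add ?_ ?_
          · rw [norm_smul, Real.norm_eq_abs]
            exact mul_le_mul g0 ((((fderiv ℝ (fun z => fderiv ℝ V z (EuclideanSpace.basisFun (Fin 3) ℝ k)) y)).le_opNorm _).trans (mul_le_mul a2 a1 (norm_nonneg _) hQ)) (norm_nonneg _) hKnn
          · rw [norm_smul, norm_mul, Real.norm_eq_abs, Real.norm_eq_abs]
            exact mul_le_mul (mul_le_mul g1 b2 (abs_nonneg _) hKnn) a1 (norm_nonneg _) (by positivity)
      _ ≤ K * ‖iteratedFDeriv ℝ 2 V y‖ ^ 2 + 2 * K * ‖fderiv ℝ V y‖ ^ 2 := by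
          nlinarith [mul_nonneg hKnn (sq_nonneg (‖iteratedFDeriv ℝ 2 V y‖ - ‖fderiv ℝ V y‖))]
  have iX : Integrable (fun y : EuclideanSpace ℝ (Fin 3) => ∑ k : Fin 3, (γ (y 2) • fderiv ℝ (fun z => fderiv ℝ V z (EuclideanSpace.basisFun (Fin 3) ℝ k)) y (fderiv ℝ V y (EuclideanSpace.basisFun (Fin 3) ℝ k)) - (deriv γ (y 2) * fderiv ℝ V y (EuclideanSpace.basisFun (Fin 3) ℝ k) 2) • fderiv ℝ V y (EuclideanSpace.basisFun (Fin 3) ℝ k))) volume := integrable_finsetSum _ fun k _ => iXk k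
  -- the divergence, pointwise
  have hpt : ∀ x : EuclideanSpace ℝ (Fin 3), VectorCalculus.divergence (fun y : EuclideanSpace ℝ (Fin 3) => ∑ k : Fin 3, (γ (y 2) • fderiv ℝ (fun z => fderiv ℝ V z (EuclideanSpace.basisFun (Fin 3) ℝ k)) y (fderiv ℝ V y (EuclideanSpace.basisFun (Fin 3) ℝ k)) - (deriv γ (y 2) * fderiv ℝ V y (EuclideanSpace.basisFun (Fin 3) ℝ k) 2) • fderiv ℝ V y (EuclideanSpace.basisFun (Fin 3) ℝ k))) x =
      γ (x 2) * ∑ k : Fin 3, frobeniusNormSq (fderiv ℝ (fun z => fderiv ℝ V z (EuclideanSpace.basisFun (Fin 3) ℝ k)) x) - γ (x 2) * frobeniusNormSq (fderiv ℝ (curl V) x) - deriv (deriv γ) (x 2) * ∑ k : Fin 3, (fderiv ℝ V x (EuclideanSpace.basisFun (Fin 3) ℝ k) 2) ^ 2 := by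
    intro x
    have hd : ∀ k ∈ (Finset.univ : Finset (Fin 3)), DifferentiableAt ℝ (fun y : EuclideanSpace ℝ (Fin 3) => (γ (y 2) • fderiv ℝ (fun z => fderiv ℝ V z (EuclideanSpace.basisFun (Fin 3) ℝ k)) y (fderiv ℝ V y (EuclideanSpace.basisFun (Fin 3) ℝ k)) - (deriv γ (y 2) * fderiv ℝ V y (EuclideanSpace.basisFun (Fin 3) ℝ k) 2) • fderiv ℝ V y (EuclideanSpace.basisFun (Fin 3) ℝ k))) x :=
      fun k _ => ((hXk k).differentiable one_ne_zero) x
    rw [divergence_fun_sum_eq Finset.univ hd]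
    have hk : ∀ k : Fin 3, VectorCalculus.divergence (fun y : EuclideanSpace ℝ (Fin 3) => (γ (y 2) • fderiv ℝ (fun z => fderiv ℝ V z (EuclideanSpace.basisFun (Fin 3) ℝ k)) y (fderiv ℝ V y (EuclideanSpace.basisFun (Fin 3) ℝ k)) - (deriv γ (y 2) * fderiv ℝ V y (EuclideanSpace.basisFun (Fin 3) ℝ k) 2) • fderiv ℝ V y (EuclideanSpace.basisFun (Fin 3) ℝ k))) x =
        γ (x 2) * frobeniusNormSq (fderiv ℝ (fun z => fderiv ℝ V z (EuclideanSpace.basisFun (Fin 3) ℝ k)) x) - γ (x 2) * ‖fderiv ℝ (curl V) x (EuclideanSpace.basisFun (Fin 3) ℝ k)‖ ^ 2 -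
          deriv (deriv γ) (x 2) * (fderiv ℝ V x (EuclideanSpace.basisFun (Fin 3) ℝ k) 2) ^ 2 := fun k => by
      rw [divergence_palinstrophyFlux hV hdiv hγ, traceCLM_comp_fderiv_fderiv_eq hV2]
      ring
    rw [Finset.sum_congr rfl fun k _ => hk k, Finset.sum_sub_distrib, Finset.sum_sub_distrib, ← Finset.mul_sum,
      ← Finset.mul_sum, ← Finset.mul_sum, ← frobeniusNormSq_eq_sum (EuclideanSpace.basisFun (Fin 3) ℝ)]
  -- the three densities are integrable
  have cγ0 : Continuous fun y : EuclideanSpace ℝ (Fin 3) => γ (y 2) := cγ.continuous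
  have cfrob : ∀ k : Fin 3, Continuous fun x : EuclideanSpace ℝ (Fin 3) => frobeniusNormSq (fderiv ℝ (fun z => fderiv ℝ V z (EuclideanSpace.basisFun (Fin 3) ℝ k)) x) := fun k =>
    (continuous_frobeniusNormSq_fderiv (hu k) (by simp))
  have jA : Integrable (fun x : EuclideanSpace ℝ (Fin 3) => γ (x 2) * ∑ k : Fin 3, frobeniusNormSq (fderiv ℝ (fun z => fderiv ℝ V z (EuclideanSpace.basisFun (Fin 3) ℝ k)) x)) volume := by
    refine (i2.const_mul (9 * K)).mono' (cγ0.mul (continuous_finsetSum _ fun k _ => cfrob k)).aestronglyMeasurable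
      (Eventually.of_forall fun x => ?_)
    rw [Real.norm_eq_abs, abs_mul, abs_of_nonneg (show (0 : ℝ) ≤ ∑ k : Fin 3, frobeniusNormSq (fderiv ℝ (fun z => fderiv ℝ V z (EuclideanSpace.basisFun (Fin 3) ℝ k)) x) from Finset.sum_nonneg fun k _ => frobeniusNormSq_nonneg _)]
    have hs : ∑ k : Fin 3, frobeniusNormSq (fderiv ℝ (fun z => fderiv ℝ V z (EuclideanSpace.basisFun (Fin 3) ℝ k)) x) ≤ 9 * ‖iteratedFDeriv ℝ 2 V x‖ ^ 2 := by
      have h3 : ∀ k : Fin 3, frobeniusNormSq (fderiv ℝ (fun z => fderiv ℝ V z (EuclideanSpace.basisFun (Fin 3) ℝ k)) x) ≤ 3 * ‖iteratedFDeriv ℝ 2 V x‖ ^ 2 := fun k =>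
        (frob_le _).trans (by nlinarith [nDu k x, norm_nonneg (fderiv ℝ (fun z => fderiv ℝ V z (EuclideanSpace.basisFun (Fin 3) ℝ k)) x)])
      calc ∑ k : Fin 3, frobeniusNormSq (fderiv ℝ (fun z => fderiv ℝ V z (EuclideanSpace.basisFun (Fin 3) ℝ k)) x) ≤ ∑ k : Fin 3, 3 * ‖iteratedFDeriv ℝ 2 V x‖ ^ 2 := Finset.sum_le_sum fun k _ => h3 k
        _ = 9 * ‖iteratedFDeriv ℝ 2 V x‖ ^ 2 := by simp; ring
    calc |γ (x 2)| * ∑ k : Fin 3, frobeniusNormSq (fderiv ℝ (fun z => fderiv ℝ V z (EuclideanSpace.basisFun (Fin 3) ℝ k)) x) ≤ K * (9 * ‖iteratedFDeriv ℝ 2 V x‖ ^ 2) :=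
          mul_le_mul (hK0 _) hs (Finset.sum_nonneg fun k _ => frobeniusNormSq_nonneg _) hKnn
      _ = 9 * K * ‖iteratedFDeriv ℝ 2 V x‖ ^ 2 := by ring
  have jF : Integrable (fun x : EuclideanSpace ℝ (Fin 3) => γ (x 2) * frobeniusNormSq (fderiv ℝ (curl V) x)) volume := by
    refine (i2.const_mul (48 * K)).mono' (cγ0.mul (continuous_frobeniusNormSq_fderiv
      (contDiff_curl (n := ⊤) hV) (by simp))).aestronglyMeasurable (Eventually.of_forall fun x => ?_)
    rw [Real.norm_eq_abs, abs_mul, abs_of_nonneg (frobeniusNormSq_nonneg (fderiv ℝ (curl V) x))]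
    have hs : frobeniusNormSq (fderiv ℝ (curl V) x) ≤ 48 * ‖iteratedFDeriv ℝ 2 V x‖ ^ 2 :=
      (frob_le _).trans (by nlinarith [ncurl x, norm_nonneg (fderiv ℝ (curl V) x)])
    calc |γ (x 2)| * frobeniusNormSq (fderiv ℝ (curl V) x) ≤ K * (48 * ‖iteratedFDeriv ℝ 2 V x‖ ^ 2) := mul_le_mul (hK0 _) hs (frobeniusNormSq_nonneg _) hKnn
      _ = 48 * K * ‖iteratedFDeriv ℝ 2 V x‖ ^ 2 := by ring
  have jG : Integrable (fun x : EuclideanSpace ℝ (Fin 3) => deriv (deriv γ) (x 2) * ∑ k : Fin 3, (fderiv ℝ V x (EuclideanSpace.basisFun (Fin 3) ℝ k) 2) ^ 2) volume := by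
    refine (i1.const_mul (3 * K)).mono' (cγ''.mul (continuous_finsetSum _ fun k _ =>
      (((EuclideanSpace.proj (2 : Fin 3) : EuclideanSpace ℝ (Fin 3) →L[ℝ] ℝ).continuous.comp (cu k)).pow 2))).aestronglyMeasurable
      (Eventually.of_forall fun x => ?_)
    rw [Real.norm_eq_abs, abs_mul, abs_of_nonneg (show (0 : ℝ) ≤ ∑ k : Fin 3, (fderiv ℝ V x (EuclideanSpace.basisFun (Fin 3) ℝ k) 2) ^ 2 from Finset.sum_nonneg fun k _ => sq_nonneg _)]
    have hs : ∑ k : Fin 3, (fderiv ℝ V x (EuclideanSpace.basisFun (Fin 3) ℝ k) 2) ^ 2 ≤ 3 * ‖fderiv ℝ V x‖ ^ 2 := by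
      have h3 : ∀ k : Fin 3, (fderiv ℝ V x (EuclideanSpace.basisFun (Fin 3) ℝ k) 2) ^ 2 ≤ ‖fderiv ℝ V x‖ ^ 2 := fun k =>
        (n2 _).trans (pow_le_pow_left₀ (norm_nonneg _) (nu k x) 2)
      calc ∑ k : Fin 3, (fderiv ℝ V x (EuclideanSpace.basisFun (Fin 3) ℝ k) 2) ^ 2 ≤ ∑ k : Fin 3, ‖fderiv ℝ V x‖ ^ 2 := Finset.sum_le_sum fun k _ => h3 k
        _ = 3 * ‖fderiv ℝ V x‖ ^ 2 := by simp
    calc |deriv (deriv γ) (x 2)| * ∑ k : Fin 3, (fderiv ℝ V x (EuclideanSpace.basisFun (Fin 3) ℝ k) 2) ^ 2 ≤ K * (3 * ‖fderiv ℝ V x‖ ^ 2) :=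
          mul_le_mul (hK2 _) hs (Finset.sum_nonneg fun k _ => sq_nonneg _) hKnn
      _ = 3 * K * ‖fderiv ℝ V x‖ ^ 2 := by ring
  have jAF : Integrable (fun x : EuclideanSpace ℝ (Fin 3) => γ (x 2) * ∑ k : Fin 3, frobeniusNormSq (fderiv ℝ (fun z => fderiv ℝ V z (EuclideanSpace.basisFun (Fin 3) ℝ k)) x) - γ (x 2) * frobeniusNormSq (fderiv ℝ (curl V) x)) volume := jA.sub jF
  have idiv : Integrable (fun x => VectorCalculus.divergence (fun y : EuclideanSpace ℝ (Fin 3) => ∑ k : Fin 3, (γ (y 2) • fderiv ℝ (fun z => fderiv ℝ V z (EuclideanSpace.basisFun (Fin 3) ℝ k)) y (fderiv ℝ V y (EuclideanSpace.basisFun (Fin 3) ℝ k)) - (deriv γ (y 2) * fderiv ℝ V y (EuclideanSpace.basisFun (Fin 3) ℝ k) 2) • fderiv ℝ V y (EuclideanSpace.basisFun (Fin 3) ℝ k))) x) volume := by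
    rw [show (fun x => VectorCalculus.divergence (fun y : EuclideanSpace ℝ (Fin 3) => ∑ k : Fin 3, (γ (y 2) • fderiv ℝ (fun z => fderiv ℝ V z (EuclideanSpace.basisFun (Fin 3) ℝ k)) y (fderiv ℝ V y (EuclideanSpace.basisFun (Fin 3) ℝ k)) - (deriv γ (y 2) * fderiv ℝ V y (EuclideanSpace.basisFun (Fin 3) ℝ k) 2) • fderiv ℝ V y (EuclideanSpace.basisFun (Fin 3) ℝ k))) x) = fun x : EuclideanSpace ℝ (Fin 3) =>
      γ (x 2) * ∑ k : Fin 3, frobeniusNormSq (fderiv ℝ (fun z => fderiv ℝ V z (EuclideanSpace.basisFun (Fin 3) ℝ k)) x) - γ (x 2) * frobeniusNormSq (fderiv ℝ (curl V) x) - deriv (deriv γ) (x 2) * ∑ k : Fin 3, (fderiv ℝ V x (EuclideanSpace.basisFun (Fin 3) ℝ k) 2) ^ 2 from funext hpt]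
    exact jAF.sub jG
  have h0 := integral_divergence_eq_zero_of_integrable hX1 iX idiv
  simp_rw [hpt] at h0
  rw [integral_sub jAF jG, integral_sub jA jF] at h0
  linarith

/-! ## 4. Identity (P), one direction at a time -/

/-- **(P) per direction: `∫γ(x₂)‖∂ₑω‖² = ∫γ(x₂)|D∂ₑV|²_F − ∫γ″(x₂)(∂ₑV₂)²`** for a divergence-free `V ∈ C^∞(ℝ³)` with
`DV, D²V ∈ L²`, an axial weight `γ ∈ C²` with `γ, γ′, γ″` bounded, and any vector `e` (`ω = curl V`, `∂ₑ = D(·)e`).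
For `e = e₂` this converts the density `g′‖∂₂ω‖²` of `Ĉ₁` (`…ConstantSpeedSlidePalinstrophyDensity`) into the `D²V`-form;
summed over a basis it is `integral_axialWeight_frobeniusNormSq_fderiv_curl_eq`. [folklore] -/
theorem integral_axialWeight_sq_norm_fderiv_curl_apply_eq (hV : ContDiff ℝ ∞ V) (hdiv : VectorCalculus.IsDivFree V)
    (hγ : ContDiff ℝ 2 γ) {K : ℝ} (hK0 : ∀ s, |γ s| ≤ K) (hK1 : ∀ s, |deriv γ s| ≤ K) (hK2 : ∀ s, |deriv (deriv γ) s| ≤ K)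
    (i1 : Integrable (fun y => ‖fderiv ℝ V y‖ ^ 2) (volume : Measure (EuclideanSpace ℝ (Fin 3))))
    (i2 : Integrable (fun y => ‖iteratedFDeriv ℝ 2 V y‖ ^ 2) (volume : Measure (EuclideanSpace ℝ (Fin 3)))) (e : EuclideanSpace ℝ (Fin 3)) :
    (∫ x, γ (x 2) * ‖fderiv ℝ (curl V) x e‖ ^ 2) =
      (∫ x, γ (x 2) * frobeniusNormSq (fderiv ℝ (fun z => fderiv ℝ V z e) x)) - ∫ x, deriv (deriv γ) (x 2) * (fderiv ℝ V x e 2) ^ 2 := by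
  have hKnn : 0 ≤ K := (abs_nonneg _).trans (hK0 0)
  have lt2 : (2 : WithTop ℕ∞) ≤ ((⊤ : ℕ∞) : WithTop ℕ∞) := WithTop.coe_le_coe.mpr le_top
  have hV2 : ContDiff ℝ 2 V := hV.of_le lt2
  have lt1 : ((1 : ℕ) : WithTop ℕ∞) ≤ ((⊤ : ℕ∞) : WithTop ℕ∞) := WithTop.coe_le_coe.mpr le_top
  have hu : ContDiff ℝ ∞ fun z => fderiv ℝ V z e := (hV.fderiv_right (m := ∞) (by exact_mod_cast le_rfl)).clm_apply contDiff_const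
  have hDu : ContDiff ℝ ∞ fun y => fderiv ℝ (fun z => fderiv ℝ V z e) y := hu.fderiv_right (m := ∞) (by exact_mod_cast le_rfl)
  have hγ'c : ContDiff ℝ 1 (deriv γ) := by
    have h2 : ContDiff ℝ (1 + 1) γ := by rw [show ((1 : WithTop ℕ∞) + 1) = 2 by norm_num]; exact hγ
    exact h2.deriv'
  have cγ : ContDiff ℝ 1 fun y : EuclideanSpace ℝ (Fin 3) => γ (y 2) :=
    (hγ.of_le (by norm_num)).comp (EuclideanSpace.proj (2 : Fin 3) : EuclideanSpace ℝ (Fin 3) →L[ℝ] ℝ).contDiff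
  have cγ' : ContDiff ℝ 1 fun y : EuclideanSpace ℝ (Fin 3) => deriv γ (y 2) := hγ'c.comp (EuclideanSpace.proj (2 : Fin 3) : EuclideanSpace ℝ (Fin 3) →L[ℝ] ℝ).contDiff
  have cγ'' : Continuous fun y : EuclideanSpace ℝ (Fin 3) => deriv (deriv γ) (y 2) :=
    (hγ'c.continuous_deriv le_rfl).comp (EuclideanSpace.proj (2 : Fin 3) : EuclideanSpace ℝ (Fin 3) →L[ℝ] ℝ).continuous
  have hc2 : ContDiff ℝ ∞ fun y : EuclideanSpace ℝ (Fin 3) => fderiv ℝ V y e 2 := (EuclideanSpace.proj (2 : Fin 3) : EuclideanSpace ℝ (Fin 3) →L[ℝ] ℝ).contDiff.comp hu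
  have hX1 : ContDiff ℝ 1 fun y : EuclideanSpace ℝ (Fin 3) => (γ (y 2) • fderiv ℝ (fun z => fderiv ℝ V z e) y (fderiv ℝ V y e) - (deriv γ (y 2) * fderiv ℝ V y e 2) • fderiv ℝ V y e) :=
    (cγ.smul ((hDu.clm_apply hu).of_le lt1)).sub ((cγ'.mul (hc2.of_le lt1)).smul (hu.of_le lt1))
  -- norm bookkeeping
  have nu : ∀ y : EuclideanSpace ℝ (Fin 3), ‖fderiv ℝ V y e‖ ≤ ‖fderiv ℝ V y‖ * ‖e‖ := fun y => (fderiv ℝ V y).le_opNorm e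
  have nDu : ∀ y : EuclideanSpace ℝ (Fin 3), ‖fderiv ℝ (fun z => fderiv ℝ V z e) y‖ ≤ ‖iteratedFDeriv ℝ 2 V y‖ * ‖e‖ := fun y => by
    rw [fderiv_fderiv_apply_eq hV2 y]
    have e1 : ‖fderiv ℝ (fderiv ℝ V) y‖ = ‖iteratedFDeriv ℝ 2 V y‖ := by
      rw [← norm_iteratedFDeriv_zero (𝕜 := ℝ) (f := fderiv ℝ (fderiv ℝ V)), norm_iteratedFDeriv_fderiv,
        norm_iteratedFDeriv_fderiv]
    rw [← e1]
    exact (fderiv ℝ (fderiv ℝ V) y).le_opNorm e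
  have n2 : ∀ w : EuclideanSpace ℝ (Fin 3), (w 2) ^ 2 ≤ ‖w‖ ^ 2 := fun w => by
    rw [EuclideanSpace.norm_sq_eq, ← sq_abs (w 2), ← Real.norm_eq_abs]
    exact Finset.single_le_sum (f := fun i => ‖w i‖ ^ 2) (fun _ _ => sq_nonneg _) (Finset.mem_univ 2)
  have frob_le : ∀ L : EuclideanSpace ℝ (Fin 3) →L[ℝ] EuclideanSpace ℝ (Fin 3), frobeniusNormSq L ≤ 3 * ‖L‖ ^ 2 := fun L => by
    rw [frobeniusNormSq_eq_sum (EuclideanSpace.basisFun (Fin 3) ℝ)]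
    have := sum_sq_norm_apply_le_card_mul_sq_opNorm (EuclideanSpace.basisFun (Fin 3) ℝ) L
    rwa [Fintype.card_fin, Nat.cast_ofNat] at this
  have ncurl : ∀ y : EuclideanSpace ℝ (Fin 3), ‖fderiv ℝ (curl V) y‖ ≤ 4 * ‖iteratedFDeriv ℝ 2 V y‖ := fun y => by
    have h := norm_iteratedFDeriv_curl_le_four hV 1 y
    rwa [← norm_iteratedFDeriv_fderiv, norm_iteratedFDeriv_zero] at h
  -- the flux is integrable
  have iX : Integrable (fun y : EuclideanSpace ℝ (Fin 3) => (γ (y 2) • fderiv ℝ (fun z => fderiv ℝ V z e) y (fderiv ℝ V y e) - (deriv γ (y 2) * fderiv ℝ V y e 2) • fderiv ℝ V y e)) volume := by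
    refine ((i2.const_mul (K * ‖e‖ ^ 2)).add (i1.const_mul (2 * K * ‖e‖ ^ 2))).mono' hX1.continuous.aestronglyMeasurable
      (Eventually.of_forall fun y => ?_)
    simp only [Pi.add_apply]
    have hP := norm_nonneg (fderiv ℝ V y)
    have hQ := norm_nonneg (iteratedFDeriv ℝ 2 V y)
    have he := norm_nonneg e
    have a1 := nu y; have a2 := nDu y; have g0 := hK0 (y 2); have g1 := hK1 (y 2)
    have b2 : |fderiv ℝ V y e 2| ≤ ‖fderiv ℝ V y‖ * ‖e‖ := by
      have := n2 (fderiv ℝ V y e)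
      nlinarith [a1, norm_nonneg (fderiv ℝ V y e), abs_nonneg (fderiv ℝ V y e 2), sq_abs (fderiv ℝ V y e 2), mul_nonneg hP he]
    calc ‖(γ (y 2) • fderiv ℝ (fun z => fderiv ℝ V z e) y (fderiv ℝ V y e) - (deriv γ (y 2) * fderiv ℝ V y e 2) • fderiv ℝ V y e)‖
        ≤ ‖γ (y 2) • fderiv ℝ (fun z => fderiv ℝ V z e) y (fderiv ℝ V y e)‖ + ‖(deriv γ (y 2) * fderiv ℝ V y e 2) • fderiv ℝ V y e‖ := norm_sub_le _ _
      _ ≤ K * (‖iteratedFDeriv ℝ 2 V y‖ * ‖e‖ * (‖fderiv ℝ V y‖ * ‖e‖)) + K * (‖fderiv ℝ V y‖ * ‖e‖) * (‖fderiv ℝ V y‖ * ‖e‖) := by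
          refine add_le_add ?_ ?_
          · rw [norm_smul, Real.norm_eq_abs]
            exact mul_le_mul g0 (((fderiv ℝ (fun z => fderiv ℝ V z e) y)).le_opNorm _ |>.trans (mul_le_mul a2 a1 (norm_nonneg _) (by positivity)))
              (norm_nonneg _) hKnn
          · rw [norm_smul, norm_mul, Real.norm_eq_abs, Real.norm_eq_abs]
            exact mul_le_mul (mul_le_mul g1 b2 (abs_nonneg _) hKnn) a1 (norm_nonneg _) (by positivity)
      _ ≤ K * ‖e‖ ^ 2 * ‖iteratedFDeriv ℝ 2 V y‖ ^ 2 + 2 * K * ‖e‖ ^ 2 * ‖fderiv ℝ V y‖ ^ 2 := by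
          nlinarith [mul_nonneg hKnn (sq_nonneg (‖iteratedFDeriv ℝ 2 V y‖ * ‖e‖ - ‖fderiv ℝ V y‖ * ‖e‖)),
            mul_nonneg hKnn (sq_nonneg (‖iteratedFDeriv ℝ 2 V y‖ * ‖e‖)), mul_nonneg hKnn (sq_nonneg (‖fderiv ℝ V y‖ * ‖e‖))]
  -- the divergence, pointwise
  have hpt : ∀ x : EuclideanSpace ℝ (Fin 3), VectorCalculus.divergence (fun y : EuclideanSpace ℝ (Fin 3) => (γ (y 2) • fderiv ℝ (fun z => fderiv ℝ V z e) y (fderiv ℝ V y e) - (deriv γ (y 2) * fderiv ℝ V y e 2) • fderiv ℝ V y e)) x =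
      γ (x 2) * frobeniusNormSq (fderiv ℝ (fun z => fderiv ℝ V z e) x) - γ (x 2) * ‖fderiv ℝ (curl V) x e‖ ^ 2 - deriv (deriv γ) (x 2) * (fderiv ℝ V x e 2) ^ 2 := fun x => by
    rw [divergence_palinstrophyFlux hV hdiv hγ, traceCLM_comp_fderiv_fderiv_eq hV2]
    ring
  -- the three densities are integrable
  have cγ0 : Continuous fun y : EuclideanSpace ℝ (Fin 3) => γ (y 2) := cγ.continuous
  have jA : Integrable (fun x : EuclideanSpace ℝ (Fin 3) => γ (x 2) * frobeniusNormSq (fderiv ℝ (fun z => fderiv ℝ V z e) x)) volume := by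
    refine (i2.const_mul (3 * K * ‖e‖ ^ 2)).mono' (cγ0.mul (continuous_frobeniusNormSq_fderiv hu (by simp))).aestronglyMeasurable
      (Eventually.of_forall fun x => ?_)
    rw [Real.norm_eq_abs, abs_mul, abs_of_nonneg (frobeniusNormSq_nonneg (fderiv ℝ (fun z => fderiv ℝ V z e) x))]
    have hs : frobeniusNormSq (fderiv ℝ (fun z => fderiv ℝ V z e) x) ≤ 3 * ‖e‖ ^ 2 * ‖iteratedFDeriv ℝ 2 V x‖ ^ 2 :=
      (frob_le _).trans (by nlinarith [nDu x, norm_nonneg (fderiv ℝ (fun z => fderiv ℝ V z e) x), mul_nonneg (norm_nonneg (iteratedFDeriv ℝ 2 V x)) (norm_nonneg e)])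
    calc |γ (x 2)| * frobeniusNormSq (fderiv ℝ (fun z => fderiv ℝ V z e) x) ≤ K * (3 * ‖e‖ ^ 2 * ‖iteratedFDeriv ℝ 2 V x‖ ^ 2) := mul_le_mul (hK0 _) hs (frobeniusNormSq_nonneg _) hKnn
      _ = 3 * K * ‖e‖ ^ 2 * ‖iteratedFDeriv ℝ 2 V x‖ ^ 2 := by ring
  have jF : Integrable (fun x : EuclideanSpace ℝ (Fin 3) => γ (x 2) * ‖fderiv ℝ (curl V) x e‖ ^ 2) volume := by
    refine (i2.const_mul (16 * K * ‖e‖ ^ 2)).mono' (cγ0.mul ((((contDiff_curl (n := ⊤) hV).continuous_fderiv (by simp)).clm_apply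
      continuous_const).norm.pow 2)).aestronglyMeasurable (Eventually.of_forall fun x => ?_)
    rw [Real.norm_eq_abs, abs_mul, abs_of_nonneg (sq_nonneg ‖fderiv ℝ (curl V) x e‖)]
    have h1 : ‖fderiv ℝ (curl V) x e‖ ≤ 4 * ‖iteratedFDeriv ℝ 2 V x‖ * ‖e‖ :=
      ((fderiv ℝ (curl V) x).le_opNorm e).trans (mul_le_mul_of_nonneg_right (ncurl x) (norm_nonneg e))
    have hs : ‖fderiv ℝ (curl V) x e‖ ^ 2 ≤ 16 * ‖e‖ ^ 2 * ‖iteratedFDeriv ℝ 2 V x‖ ^ 2 := by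
      nlinarith [h1, norm_nonneg (fderiv ℝ (curl V) x e), mul_nonneg (norm_nonneg (iteratedFDeriv ℝ 2 V x)) (norm_nonneg e)]
    calc |γ (x 2)| * ‖fderiv ℝ (curl V) x e‖ ^ 2 ≤ K * (16 * ‖e‖ ^ 2 * ‖iteratedFDeriv ℝ 2 V x‖ ^ 2) := mul_le_mul (hK0 _) hs (sq_nonneg _) hKnn
      _ = 16 * K * ‖e‖ ^ 2 * ‖iteratedFDeriv ℝ 2 V x‖ ^ 2 := by ring
  have jG : Integrable (fun x : EuclideanSpace ℝ (Fin 3) => deriv (deriv γ) (x 2) * (fderiv ℝ V x e 2) ^ 2) volume := by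
    refine (i1.const_mul (K * ‖e‖ ^ 2)).mono' (cγ''.mul (((EuclideanSpace.proj (2 : Fin 3) : EuclideanSpace ℝ (Fin 3) →L[ℝ] ℝ).continuous.comp
      hu.continuous).pow 2)).aestronglyMeasurable (Eventually.of_forall fun x => ?_)
    rw [Real.norm_eq_abs, abs_mul, abs_of_nonneg (sq_nonneg (fderiv ℝ V x e 2))]
    have hs : (fderiv ℝ V x e 2) ^ 2 ≤ ‖e‖ ^ 2 * ‖fderiv ℝ V x‖ ^ 2 :=
      (n2 _).trans (by nlinarith [nu x, norm_nonneg (fderiv ℝ V x e), mul_nonneg (norm_nonneg (fderiv ℝ V x)) (norm_nonneg e)])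
    calc |deriv (deriv γ) (x 2)| * (fderiv ℝ V x e 2) ^ 2 ≤ K * (‖e‖ ^ 2 * ‖fderiv ℝ V x‖ ^ 2) := mul_le_mul (hK2 _) hs (sq_nonneg _) hKnn
      _ = K * ‖e‖ ^ 2 * ‖fderiv ℝ V x‖ ^ 2 := by ring
  have jAF : Integrable (fun x : EuclideanSpace ℝ (Fin 3) => γ (x 2) * frobeniusNormSq (fderiv ℝ (fun z => fderiv ℝ V z e) x) - γ (x 2) * ‖fderiv ℝ (curl V) x e‖ ^ 2) volume := jA.sub jF
  have idiv : Integrable (fun x => VectorCalculus.divergence (fun y : EuclideanSpace ℝ (Fin 3) => (γ (y 2) • fderiv ℝ (fun z => fderiv ℝ V z e) y (fderiv ℝ V y e) - (deriv γ (y 2) * fderiv ℝ V y e 2) • fderiv ℝ V y e)) x) volume := by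
    rw [show (fun x => VectorCalculus.divergence (fun y : EuclideanSpace ℝ (Fin 3) => (γ (y 2) • fderiv ℝ (fun z => fderiv ℝ V z e) y (fderiv ℝ V y e) - (deriv γ (y 2) * fderiv ℝ V y e 2) • fderiv ℝ V y e)) x) = fun x : EuclideanSpace ℝ (Fin 3) =>
      γ (x 2) * frobeniusNormSq (fderiv ℝ (fun z => fderiv ℝ V z e) x) - γ (x 2) * ‖fderiv ℝ (curl V) x e‖ ^ 2 - deriv (deriv γ) (x 2) * (fderiv ℝ V x e 2) ^ 2 from funext hpt]
    exact jAF.sub jG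
  have h0 := integral_divergence_eq_zero_of_integrable hX1 iX idiv
  simp_rw [hpt] at h0
  rw [integral_sub jAF jG, integral_sub jA jF] at h0
  linarith

end ExtremiserLiouville

end Summit.NavierStokesRegularity.NavierStokesRegularity.Theorems

end
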